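import Summits.HubbardSuperconductivity.HubbardSuperconductivity.Theorems.BalabanIRBirGappedPhaseReductionSectorFourier
import Literature.MathematicalPhysics.QuantumLattice.FreeFermionSpinTwistedTraceFormula

/-!
# Route BalabanIR — crux 4 `BirGappedPhaseReduction` (item `stmt-HubbardSuperconductivity-2082`): the `U = 0` calibration of the canonical functional integral — sector partition functions as Fourier integrals of determinants

Dictionary steps (1) + (3) of the reduction, carried out EXACTLY at `U = 0`: the canonical
`(N↑, N↓) = (a, b)` partition function of free lattice fermions is the double Fourier coefficient
of a product of two one-body determinants,

  `tr (P_{(a,b)} e^{-βH₀}) = (2π)⁻² ∫₀^{2π}∫₀^{2π} e^{-i(aφ + bχ)} det(1 + e^{iφ}e^{-βh}) det(1 + e^{iχ}e^{-βh}) dχ dφ`,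

`H₀ = H(t, 0) - μN = dΓ(h ⊕ h)`, `h = -t·[x ∼ y] - μδ_{xy}`: the sector projection is the integral
over the global gauge (zero) modes (`trace_sectorIndicator_mul_eq_integral`,
`Theorems/…SectorFourier`), and at each value of the twists the fermions integrate to one
determinant per spin species with the twists as imaginary chemical potentials
(`trace_exp_spinTwist_mul_gibbsWeight_freeHubbard`, `Literature/…/FreeFermionSpinTwistedTraceFormula`).

* `trace_sectorIndicator_gibbsWeight_freeHubbard_eq_integral` — the display, for the Hubbard
  Hamiltonian at `U = 0` on any finite graph;
* `sectorPartitionFn_free_hubbardTorus_eq_integral` — the route's objects: `H = hubbardTorus 2 L t 0`,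
  `S = szSector (2m) 0`, `tr (P_S e^{-βH})` (the denominator of the canonical Gibbs average in
  `birTraceBound_of_eventually_thermal` at `U = 0`).

Theses-free (imports a Theses-free Theorems module and Literature only). Sources: J. Dereziński,
C. Gérard, *Mathematics of Quantization and Quantum Fields* §17.2; the particle-number projection
`P_N = (2π)⁻¹∫e^{iφ(N̂-N)}dφ` of free-fermion / BCS states is folklore. No definition is introduced.
-/

noncomputable section

open scoped Matrix.Norms.L2Operator ComplexOrder MatrixOrder InnerProductSpace

namespace Summit.HubbardSuperconductivity.HubbardSuperconductivity.Theorems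

open Matrix Complex MeasureTheory intervalIntegral NormedSpace Literature.MathematicalPhysics.QuantumLattice

section Graph

variable {Λ : Type*} [LinearOrder Λ] [Fintype Λ] (G : SimpleGraph Λ) [DecidableRel G.Adj]

/-- The twist of the sector-projection formula is the exponential of the spin-resolved number
operators with parameters `(iφ, iχ)`. [folklore] -/
theorem spinTwist_diagonal_eq_exp_sum (φ χ : ℝ) :
    (diagonal fun s : Finset (Orb Λ) =>
        cexp (((((upPart s).card : ℝ) * φ + ((downPart s).card : ℝ) * χ : ℝ) : ℂ) * I)) =
      exp (∑ σ : Fin 2, (![(φ : ℂ) * I, (χ : ℂ) * I] σ) • ∑ x : Λ, numberAt (orb x σ)) := by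
  rw [exp_sum_smul_spinNumber_eq_diagonal]
  congr 1
  funext s
  congr 1
  simp only [Matrix.cons_val_zero, Matrix.cons_val_one]
  push_cast
  ring

/-- **The canonical partition function of free lattice fermions as a Fourier integral of
determinants.** For the Hubbard Hamiltonian at `U = 0`, `H₀ = H(t,0) - μN` on a finite graph, real
`β` and a joint sector `(N↑, N↓) = (a, b)`:
`tr (𝟙_{(a,b)} e^{-βH₀}) = (2π)⁻² ∫₀^{2π}∫₀^{2π} e^{-i(aφ+bχ)} det(1 + e^{iφ}e^{-βh}) det(1 + e^{iχ}e^{-βh}) dχ dφ`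
with the site matrix `h = -t·[x ∼ y] - μ δ_{xy}` — the `U = 0` instance of the reduction: the
canonical projection is the integral over the global gauge modes and the fermions integrate to one
determinant per spin species. Folklore; Dereziński–Gérard §17.2. [folklore] -/
theorem trace_sectorIndicator_gibbsWeight_freeHubbard_eq_integral (t μ β : ℝ) (a b : ℕ) :
    ((diagonal fun s : Finset (Orb Λ) =>
        if (upPart s).card = a ∧ (downPart s).card = b then (1 : ℂ) else 0) *
          gibbsWeight β (hamiltonianWith G t 0 μ)).trace =
      (1 / (2 * Real.pi) ^ 2 : ℂ) *
        ∫ φ in (0:ℝ)..2 * Real.pi, ∫ χ in (0:ℝ)..2 * Real.pi,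
          cexp (-((((a : ℝ) * φ + (b : ℝ) * χ : ℝ) : ℂ) * I)) *
            ((1 + cexp ((φ : ℂ) * I) • gibbsWeight β (Matrix.of fun x y : Λ =>
                (if G.Adj x y then -(t : ℂ) else 0) - (if x = y then (μ : ℂ) else 0))).det *
              (1 + cexp ((χ : ℂ) * I) • gibbsWeight β (Matrix.of fun x y : Λ =>
                (if G.Adj x y then -(t : ℂ) else 0) - (if x = y then (μ : ℂ) else 0))).det) := by
  rw [trace_sectorIndicator_mul_eq_integral]
  have hpt : ∀ φ χ : ℝ,
      ((diagonal fun s : Finset (Orb Λ) =>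
          cexp (((((upPart s).card : ℝ) * φ + ((downPart s).card : ℝ) * χ : ℝ) : ℂ) * I)) *
            gibbsWeight β (hamiltonianWith G t 0 μ)).trace =
        (1 + cexp ((φ : ℂ) * I) • gibbsWeight β (Matrix.of fun x y : Λ =>
            (if G.Adj x y then -(t : ℂ) else 0) - (if x = y then (μ : ℂ) else 0))).det *
          (1 + cexp ((χ : ℂ) * I) • gibbsWeight β (Matrix.of fun x y : Λ =>
            (if G.Adj x y then -(t : ℂ) else 0) - (if x = y then (μ : ℂ) else 0))).det := by
    intro φ χ
    rw [spinTwist_diagonal_eq_exp_sum, trace_exp_spinTwist_mul_gibbsWeight_freeHubbard,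
      Fin.prod_univ_two]
    simp only [Matrix.cons_val_zero, Matrix.cons_val_one]
  simp_rw [hpt]

end Graph

/-! ### The free Hubbard torus of the route -/

section Torus

variable (L : ℕ)

/-- **The route's canonical partition function at `U = 0`.** For `H = hubbardTorus 2 L t 0` and
the sector `S = szSector (2m) 0`:
`tr (P_S e^{-βH}) = (2π)⁻² ∫₀^{2π}∫₀^{2π} e^{-im(φ+χ)} det(1 + e^{iφ}e^{-βh}) det(1 + e^{iχ}e^{-βh}) dχ dφ`,
`h = -t·[x ∼ y]` the torus hopping matrix — the `U = 0` value of the denominator of the canonical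
Gibbs average in `birTraceBound_of_eventually_thermal`. Folklore. [folklore] -/
theorem sectorPartitionFn_free_hubbardTorus_eq_integral (t β : ℝ) (m : ℕ) :
    (projMatrix ((szSector (Λ := FermionTorus 2 L) (2 * m) 0).map
        (Fock.toEuclidean (ι := Orb (FermionTorus 2 L)) :
          Fock (Orb (FermionTorus 2 L)) →ₗ[ℂ] EuclideanSpace ℂ (Finset (Orb (FermionTorus 2 L))))) *
        gibbsWeight β (hubbardTorus 2 L t 0)).trace =
      (1 / (2 * Real.pi) ^ 2 : ℂ) *
        ∫ φ in (0:ℝ)..2 * Real.pi, ∫ χ in (0:ℝ)..2 * Real.pi,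
          cexp (-((((m : ℝ) * φ + (m : ℝ) * χ : ℝ) : ℂ) * I)) *
            ((1 + cexp ((φ : ℂ) * I) • gibbsWeight β (Matrix.of fun x y : FermionTorus 2 L =>
                (if (fermionTorusGraph 2 L).Adj x y then -(t : ℂ) else 0) -
                  (if x = y then ((0 : ℝ) : ℂ) else 0))).det *
              (1 + cexp ((χ : ℂ) * I) • gibbsWeight β (Matrix.of fun x y : FermionTorus 2 L =>
                (if (fermionTorusGraph 2 L).Adj x y then -(t : ℂ) else 0) -
                  (if x = y then ((0 : ℝ) : ℂ) else 0))).det) := by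
  rw [projMatrix_szSector_fermionTorus_eq_diagonal]
  have hH : hubbardTorus 2 L t 0 = hamiltonianWith (fermionTorusGraph 2 L) t 0 0 := by
    rw [hamiltonianWith_zero]
    rfl
  rw [hH]
  convert trace_sectorIndicator_gibbsWeight_freeHubbard_eq_integral (fermionTorusGraph 2 L) t 0 β m m

end Torus

end Summit.HubbardSuperconductivity.HubbardSuperconductivity.Theorems
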